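import Mathlib

/-!
# A1Eigenlines — the linear-algebra core of Tier-4 sub-claim A1 (the correspondence construction)

Cell pub-hodge-repro2, seat p7 (sole filer of this file). Companion of `route/T4-A1-p7.md`
(TIER4 §A0–§A3: the `F`-eigenlines of `H¹(A_i, ℂ)`, their Hodge types, the split Weil space).
Nothing below mentions a variety: each statement is the linear algebra that the prose step uses,
with the geometric input (a CM abelian variety, its Lie algebra, its cohomology) left to the prose.

* `dualMap_dualBasis_eq_smul` — Lemma A0.5, the computation: if a basis `b` of `V` consists of
  eigenvectors of `φ` with eigenvalues `c i`, then the dual basis is a basis of eigenvectors of the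
  transpose `φ.dualMap` with the SAME eigenvalues.  (Prose: `V = Lie(A_i)`, `b = (v_{i,σ})_{σ ∈ T_i}`,
  `φ = ρ_a(ι_i(x))`, `c σ = σ(x)`; the dual basis `(ω_{i,σ})` spans the holomorphic eigenlines.)
* `conj_mem_eigenspace_conj` — A0.4, the `κ` step: a conjugate-linear map commuting with a
  `ℂ`-linear operator `T` sends the `c`-eigenspace of `T` into the `conj c`-eigenspace
  (prose: `κ(ℓ_{i,σ}) ⊆ ℓ_{i,σ̄}`).
* `finrank_eq_one_of_finrank_eq` — A0.4 / A3.1: a module over a field `K ⊇ ℚ` whose `ℚ`-dimension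
  equals `[K : ℚ]` is a `K`-line (prose: `H¹(A_i, ℚ)` is an `F`-line; `W_F(B)` is an `R_W`-line).
* `eigenspace_eq_span_of_dualBasis` — the eigenline is spanned by the dual-basis vector when the
  eigenvalues are pairwise distinct (prose: `ℓ_{i,σ} = ℂ ω_{i,σ}` for `σ ∈ T_i`).

Sources: Lange, Abelian Varieties over the Complex Numbers (2023), §1.1.2 (analytic representation),
§1.1.5 (Hodge decomposition of a torus); Shimura 1998 §5 (chunk p0051: the eigen-1-forms
`δι(α)ω_i = α^{φ_i} ω_i`). Standard axioms only.
-/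

namespace Summit.Ventures.HodgeRepro2.A1Eigenlines

open Module

section DualBasis

variable {K V ι : Type*} [Field K] [AddCommGroup V] [Module K V] [Fintype ι] [DecidableEq ι]

/-- Lemma A0.5 (computation). If `b` is a basis of eigenvectors of `φ` (`φ (b i) = c i • b i`),
then every dual-basis vector `b.dualBasis i` is an eigenvector of the transpose `φ.dualMap`
with the same eigenvalue `c i`. In the prose: the invariant holomorphic 1-forms dual to the
eigenbasis of `Lie(A_i)` satisfy `ι_i(x)^* ω_{i,σ} = σ(x) ω_{i,σ}` (Shimura 1998 chunk p0051 ll. 1–5,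
`δι(α)ω_i = α^{φ_i} ω_i`). -/
theorem dualMap_dualBasis_eq_smul (b : Basis ι K V) (φ : V →ₗ[K] V) (c : ι → K)
    (h : ∀ i, φ (b i) = c i • b i) (i : ι) :
    φ.dualMap (b.dualBasis i) = c i • b.dualBasis i := by
  apply b.ext
  intro j
  simp only [LinearMap.dualMap_apply, LinearMap.smul_apply, smul_eq_mul, h j, map_smul,
    Basis.dualBasis_apply_self]
  by_cases hij : j = i
  · subst hij
    simp
  · simp [hij]

/-- The dual-basis vector `b.dualBasis i` lies in the `c i`-eigenspace of the transpose. -/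
theorem dualBasis_mem_eigenspace (b : Basis ι K V) (φ : V →ₗ[K] V) (c : ι → K)
    (h : ∀ i, φ (b i) = c i • b i) (i : ι) :
    b.dualBasis i ∈ Module.End.eigenspace φ.dualMap (c i) := by
  rw [Module.End.mem_eigenspace_iff]
  exact dualMap_dualBasis_eq_smul b φ c h i

/-- When the eigenvalues `c` are pairwise distinct, the `c i`-eigenspace of the transpose is
exactly the line spanned by `b.dualBasis i` (prose: `ℓ_{i,σ} = ℂ ω_{i,σ}`; the prose obtains the
one-dimensionality from the `F`-line structure instead, A0.4 — this is the direct route). -/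
theorem eigenspace_eq_span_of_dualBasis (b : Basis ι K V) (φ : V →ₗ[K] V) (c : ι → K)
    (h : ∀ i, φ (b i) = c i • b i) (hc : Function.Injective c) (i : ι) :
    Module.End.eigenspace φ.dualMap (c i) = K ∙ b.dualBasis i := by
  apply le_antisymm
  · intro ψ hψ
    rw [Module.End.mem_eigenspace_iff] at hψ
    -- expand ψ in the dual basis; the coefficient at j ≠ i vanishes
    have hcoef : ∀ j, j ≠ i → ψ (b j) = 0 := by
      intro j hj
      have h1 : (φ.dualMap ψ) (b j) = (c i • ψ) (b j) := by rw [hψ]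
      simp only [LinearMap.dualMap_apply, LinearMap.smul_apply, smul_eq_mul, h j, map_smul] at h1
      have hne : c j - c i ≠ 0 := sub_ne_zero.mpr (fun e => hj (hc e))
      have : (c j - c i) * ψ (b j) = 0 := by rw [sub_mul, h1]; ring
      exact (mul_eq_zero.mp this).resolve_left hne
    rw [Submodule.mem_span_singleton]
    refine ⟨ψ (b i), ?_⟩
    apply b.ext
    intro j
    simp only [LinearMap.smul_apply, Basis.dualBasis_apply_self, smul_eq_mul]
    by_cases hij : j = i
    · subst hij; simp
    · simp [hij, hcoef j hij]
  · rw [Submodule.span_singleton_le_iff_mem]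
    exact dualBasis_mem_eigenspace b φ c h i

end DualBasis

section Conj

variable {V : Type*} [AddCommGroup V] [Module ℂ V]

/-- A0.4, the `κ` step: a conjugate-linear map `κ` commuting with a `ℂ`-linear `T` maps the
`c`-eigenspace of `T` into the `conj c`-eigenspace (prose: `κ(ℓ_{i,σ}) ⊆ ℓ_{i,σ̄}`, with
`T = ι_i(x)^*`, `c = σ(x)`, `conj c = σ̄(x)`). -/
theorem conj_mem_eigenspace_conj (T : V →ₗ[ℂ] V) (κ : V →ₗ⋆[ℂ] V)
    (hκ : ∀ v, T (κ v) = κ (T v)) {c : ℂ} {v : V}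
    (hv : v ∈ Module.End.eigenspace T c) :
    κ v ∈ Module.End.eigenspace T (starRingEnd ℂ c) := by
  rw [Module.End.mem_eigenspace_iff] at hv ⊢
  rw [hκ, hv, LinearMap.map_smulₛₗ]

/-- The eigenspace inclusion of `conj_mem_eigenspace_conj` as a statement about submodules:
`κ` maps `eigenspace T c` into `eigenspace T (conj c)`. -/
theorem map_eigenspace_le (T : V →ₗ[ℂ] V) (κ : V →ₗ⋆[ℂ] V)
    (hκ : ∀ v, T (κ v) = κ (T v)) (c : ℂ) :
    (Module.End.eigenspace T c).map κ ≤ Module.End.eigenspace T (starRingEnd ℂ c) := by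
  rintro _ ⟨v, hv, rfl⟩
  exact conj_mem_eigenspace_conj T κ hκ hv

end Conj

section Finrank

variable (K W : Type*) [Field K] [Algebra ℚ K] [FiniteDimensional ℚ K]
  [AddCommGroup W] [Module ℚ W] [Module K W] [IsScalarTower ℚ K W]

/-- A0.4 / A3.1: a `K`-module `W` (`K ⊇ ℚ` a number field) with `dim_ℚ W = [K : ℚ]` is a `K`-line
(prose: `H¹(A_i, ℚ)`, of `ℚ`-dimension `6 = [F : ℚ]`, is an `F`-line; `W_F(B)`, of `ℚ`-dimension `6`,
is a line over `R_W ≅ F`). -/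
theorem finrank_eq_one_of_finrank_eq (h : finrank ℚ W = finrank ℚ K) : finrank K W = 1 := by
  have hmul : finrank ℚ K * finrank K W = finrank ℚ W := Module.finrank_mul_finrank ℚ K W
  have hK : 0 < finrank ℚ K := Module.finrank_pos
  rw [h] at hmul
  exact Nat.eq_of_mul_eq_mul_left hK (hmul.trans (mul_one _).symm)

end Finrank

end Summit.Ventures.HodgeRepro2.A1Eigenlines
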